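import Literature.NumberTheory.LFunctions.Zhang2022.DHMenuConsistentRow04Low
import Literature.NumberTheory.LFunctions.Zhang2022.DHChainBarrierPrimes
import Literature.NumberTheory.LFunctions.TwistedLogFreeDensityMotohashi
import Literature.NumberTheory.LFunctions.KadiriDirichletExceptionalZero
import HarnessLib

/-!
# B-DH-W, the INFORMAL rows: `Zhang2022.DH.MenuInformalConsistent` — the typed part of `M_informal`
# rendered over the (A)-world with constants UNIFORM in `D`, and PROVED
# (cell `landau-siegel`, family B-dh KILLED; §E item S-E-bd1-3, ls-barrier-plan g1 2026-08-26T22:26:24Z; REF-E E-18c)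

Topic `Literature/NumberTheory/LFunctions/Zhang2022` (namespace `Literature.NumberTheory.LFunctions.Zhang2022.DH`,
next to `DHChainBarrier.lean` = `MenuConsistent` (E-057, M_typed; PROVED `menuConsistent_holds` p468827) and
`DHChainBarrierPrimes.lean` = `MenuConsistentPrimes` (M_primes; §E E-18b)). CONSISTENCY-MODEL CURRENCY (director-frontier
g6 2026-08-26T19:31:07Z): this file extends the B-dh done-sentence from `M_typed ∪ M_primes` to the TYPED PART of
`M_informal` (KILL-draft v1.4.5 §1: «IN THE INFORMAL CLASS Σ_menu BUT NOT INSTANTIATED (met by W⁺ by inspection,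
recorded here, not kernel): dhE-07, BGTZ Cor 1.2, Kadiri ∃R₀ ZFR, dhE-14, dhE-18(ii), dhE-28»); it says NOTHING about
untyped menu rows (dhE-18(ii), dhE-20) and nothing about any actual `L`-function. PART 1 = the zero-density / zero-free
rows with inexplicit constants (dhE-07, dhE-28, BGTZ Cor. 1.2, Kadiri ∃R₀); the critical-line PROPORTION rows of dhE-14
(`conreyIwaniecSoundararajanCriticalZeros_theorem1`, `sono2025_theorem11`, `wu2019_theorem2` — family / single-character
proportions of simple zeros on `Re s = ½`, with `∃ Q₀` / `∃ T₀` thresholds) are a companion certificate (part 2, on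
ls-Bdh-plan's row confirmation), so that this statement is never re-rendered.

## What is typed (statement) and proved (theorem)

The rows of `M_informal` that ARE named Literature decls carry INEXPLICIT constants (`∃ C`, `∃ c₀`, `∃ C(ε)`,
`∃ R₀`). The honest rendering over the family of worlds `W(D, χ)` places those existentials BEFORE `∀ D`
(a per-world constant would be a costume): `MenuInformalConsistent := ∃ constants, ∀ D χ (log D ≥ 43 250, χ primitive
quadratic ≠ χ₀), MenuInformal … (world D χ)`, where `ZeroWorld.MenuInformal` has ONE FIELD PER TYPED ROW, each the
decl's statement read VERBATIM on the world's zero data (`L(ρ,χ) = 0 ↦ w.IsZero q χ ρ`, `zeroOrder ↦ w.mult`), with the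
decl's counting objects rebuilt verbatim over a world (§1):
* `row07` ↔ dhE-07 = `Literature.NumberTheory.LFunctions.thornerZaman2024PNTAP_theorem7_repulsive` (Thorner–Zaman,
  Math. Z. 2024, Thm 7 second display: `N_q*(σ,T) ≤ C·ν(qT)·(qT)^{(75/4)(1−σ)}`, `ν = min{1,(1−β₁)log(qT)}`, for
  `q, T ≥ 1`, `0 ≤ σ ≤ 1`, when `(β₁,χ₁)` exists) on `w.modZeroCountExcl` (= the source's `modZeroCountExcl`, `Set.ncard`
  of `{ρ : zero, Re ρ ≥ σ, |Im ρ| ≤ T}`) and `w.exceptionalPair` (`DHChainBarrierPrimes`);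
* `row28` ↔ dhE-28 = `Literature.NumberTheory.LFunctions.motohashi1977_theoremII` (Motohashi 1977 II: for every `ε > 0`
  constants `c₀(ε), C(ε) > 0` with `N(α,T;χ₁,{β₁}) ≤ C(1−β₁)log(qT)(q⁷T⁴)^{(1+ε)(1−α)/(3α−2)}`, `3/4 < α ≤ 1`) on
  `w.charZeroCountStrip` (= the source's `charZeroCount χ α T E`: multiplicities summed over the open-strip box minus `E`);
* `rowCor12` ↔ BGTZ Cor. 1.2 = `Literature.NumberTheory.LFunctions.BGTZ2025.corollary12` (ineffective `C(ε) ≤ qT` ⇒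
  repulsion (1.2) with `c = (4/3+ε, 2/3+ε, 0, 1/24)`) on `w.repulsion` (= the source's `BGTZ2025.Repulsion` over the
  world; its instance `(10, 1, 107, 1/16)` is row01 of E-057) — VACUOUS in `W` exactly like row01 (no zero `ρ ≠ β₁` with
  `Re ρ > ½`), displayed as such;
* `rowKadiri` ↔ "Kadiri ∃R₀" = `Literature.NumberTheory.LFunctions.Kadiri2018.dirichlet_atMostOneZero` (at most one
  zero, real and of a quadratic character, in `Re s ≥ 1 − 1/(R₀ log max{q, q|Im s|})`, `q ≥ 3`) on `w.IsZero`.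
THE THEOREM `menuInformalConsistent_holds : MenuInformalConsistent` with the witnesses `C₇ = 2`, `c₀ ≡ 1/10`,
`C₂₈ ≡ 1`, `C₁₂ ≡ 0`, `R₀ = 10`: row07 because an exceptional pair of `W(D,χ)` lives on an induced slot (`D ∣ q`, so
`qT ≥ D`, `log(qT) ≥ 𝓛`), the count vanishes for `σ > ½` and is `≤ 2(qT)³` for `σ ≤ ½` (every slot's box has
`≤ 2·fenceCount + 2 ≤ (qT)²` points — `two_fenceCount_add_two_le` of ls-Bdh-typer-1 g0 — and there are `≤ q` characters),
while `ν(qT)(qT)^{75(1−σ)/4} ≥ δ𝓛·(qT)⁹` and `δ𝓛e^{6𝓛} ≥ 1` (`DHMenuLines.bordignon_lt_delta`); row28 because the strip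
box of `W` has no zero with `Re ρ > ¾` except `β₁` (excluded); rowCor12 and rowKadiri by the structural lemma
`re_gt_half_zero` (any zero with `Re ρ > ½` is `β₁(D)` on the unique induced slot of its level).

WHAT THIS IS NOT: not a change to the frozen KILL text (E-057 stays as countersigned; this is a SEPARATE certificate whose
scope note is ls-Bdh-plan's); not a statement about untyped rows; no `L`-function; no verdict. «The programme SEARCHES and
TYPES; no claim about Landau–Siegel zeros, Theorems 1–2 of arXiv:2211.02515 or a repaired Margin232 until a kernel theorem
says so.»

## References

* `pub/landau-siegel/B-dh/KILL-draft.md` v1.4.5 §1 (M_informal list), `B-dh/EDLIST.md` v1.5 rows dhE-07, dhE-28,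
  `B-dh/DESIGN-MAP-dh.md` v1.4 (M_informal column); ls-barrier-plan g1 INBOX 2026-08-26T22:26:24Z (3) (item S-E-bd1-3).
* [ThornerZaman2024PNTAP] Theorem 7; [Motohashi1977DeuringHeilbronnII] Theorem p.25; [BenliGoelTwissZaman2025] Cor. 1.2;
  [Kadiri2018] Thm 1.1; [Zhang2022LandauSiegel] §2 Assumption (A); [BennettMartinOBryantRechnitzer2021] Thm 1.1.
-/

noncomputable section

open scoped Classical
open Complex

namespace Literature.NumberTheory.LFunctions.Zhang2022.DH

open ThornerZaman2024PNTAP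

/-! ## 1. The sources' counting objects, rebuilt verbatim over a zero world -/

namespace ZeroWorld

variable (w : ZeroWorld)

/-- `{ρ = β+iγ : β ≥ σ, |γ| ≤ T, L(ρ,χ) = 0}` over the world (= `ThornerZaman2024PNTAP.zeroSetGe`).
[cite: ThornerZaman2024PNTAP, §2 (display defining N_χ(σ,T)) p.6] -/
def zeroSetGe (q : ℕ) (χ : DirichletCharacter ℂ q) (σ T : ℝ) : Set ℂ :=
  {ρ | w.IsZero q χ ρ ∧ σ ≤ ρ.re ∧ |ρ.im| ≤ T}

/-- `N_χ(σ,T)` over the world (= `ThornerZaman2024PNTAP.charZeroCountGe`, a `Set.ncard`).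
[cite: ThornerZaman2024PNTAP, §2 (display defining N_χ(σ,T)) p.6] -/
def charZeroCountGe (q : ℕ) (χ : DirichletCharacter ℂ q) (σ T : ℝ) : ℕ :=
  (w.zeroSetGe q χ σ T).ncard

/-- `N*_{χ₁}(σ,T)` over the world: the count with `β₁` removed (= `ThornerZaman2024PNTAP.charZeroCountGeExcl`).
[cite: ThornerZaman2024PNTAP, §2 (display defining N*_{χ₁}(σ,T)) p.6] -/
def charZeroCountGeExcl (q : ℕ) (χ₁ : DirichletCharacter ℂ q) (β₁ σ T : ℝ) : ℕ :=
  (w.zeroSetGe q χ₁ σ T \ {((β₁ : ℝ) : ℂ)}).ncard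

/-- `N_q*(σ,T) = ∑_{χ ≠ χ₁} N_χ(σ,T) + N*_{χ₁}(σ,T)` over the world (= `ThornerZaman2024PNTAP.modZeroCountExcl`).
[cite: ThornerZaman2024PNTAP, §2 (display defining N_q*(σ,T)) p.6] -/
def modZeroCountExcl (q : ℕ) [NeZero q] (χ₁ : DirichletCharacter ℂ q) (β₁ σ T : ℝ) : ℕ :=
  (∑ χ : DirichletCharacter ℂ q, if χ = χ₁ then 0 else w.charZeroCountGe q χ σ T) +
    w.charZeroCountGeExcl q χ₁ β₁ σ T

/-- `N(α, T; χ, E)` over the world (= `Literature.NumberTheory.LFunctions.charZeroCount χ α T E`: multiplicities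
summed over the open-strip box `{0 < Re ρ < 1, |Im ρ| ≤ T}` minus the exclusion set `E`, on `Re ρ ≥ α`; `0` if the
box is infinite). [cite: Bombieri1987GrandCrible, §6 Théorème 14] -/
def charZeroCountStrip (q : ℕ) (χ : DirichletCharacter ℂ q) (α T : ℝ) (E : Finset ℂ) : ℝ :=
  if h : {ρ : ℂ | w.IsZero q χ ρ ∧ 0 < ρ.re ∧ ρ.re < 1 ∧ |ρ.im| ≤ T}.Finite then
    ∑ ρ ∈ (h.toFinset \ E).filter (fun ρ => α ≤ ρ.re), (w.mult q χ ρ : ℝ)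
  else 0

/-- "(1.2) holds for the modulus `q` at height `T` with constants `c₁, c₂, c₃, c₄`" over the world
(= `BGTZ2025.Repulsion c₁ c₂ c₃ c₄ q T` with `L(ρ,χ) = 0 ↦ w.IsZero q χ ρ`). [cite: BenliGoelTwissZaman2025, Corollary 1.1 (1.2)] -/
def repulsion (c₁ c₂ c₃ c₄ : ℝ) (q : ℕ) (T : ℝ) : Prop :=
  ∀ (χ₁ : DirichletCharacter ℂ q) (β₁ : ℝ), 1 - 1 / (10 * Real.log q) < β₁ → β₁ < 1 →
    w.IsZero q χ₁ β₁ →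
      ∀ (χ : DirichletCharacter ℂ q) (ρ : ℂ), ρ ≠ 1 → ρ ≠ (β₁ : ℂ) → w.IsZero q χ ρ →
        1 / 2 < ρ.re → |ρ.im| ≤ T → ρ.re < BGTZ2025.repulsionBound c₁ c₂ c₃ c₄ q T β₁

/-! ## 2. The informal menu (one field per TYPED row of `M_informal`) and the certificate statement -/

/-- **THE INFORMAL MENU over a world**, constants as PARAMETERS (they are quantified ONCE, before `∀ D`, in
`MenuInformalConsistent`): one field per typed row of `M_informal`, each the Literature decl read verbatim on the world's
data. SCOPE: the typed part of `M_informal` as listed in the module docstring; untyped rows are not rendered.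
[cite: Zhang2022LandauSiegel, §2 Assumption (A)] -/
structure MenuInformal (C₇ : ℝ) (c₀ C₂₈ C₁₂ : ℝ → ℝ) (R₀ : ℝ) : Prop where
  /-- dhE-07 = `thornerZaman2024PNTAP_theorem7_repulsive` (its `∃ C` is the parameter `C₇`). -/
  row07 : ∀ (q : ℕ) [NeZero q] (χ₁ : DirichletCharacter ℂ q) (β₁ : ℝ), w.exceptionalPair χ₁ β₁ →
    ∀ (T σ : ℝ), 1 ≤ T → 0 ≤ σ → σ ≤ 1 →
      (w.modZeroCountExcl q χ₁ β₁ σ T : ℝ) ≤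
        C₇ * nu β₁ ((q : ℝ) * T) * ((q : ℝ) * T) ^ ((75 : ℝ) / 4 * (1 - σ))
  /-- dhE-28 = `motohashi1977_theoremII` (its `∃ c₀, ∃ C` for each `ε` are the parameters `c₀ ε`, `C₂₈ ε`). -/
  row28 : ∀ ε : ℝ, 0 < ε →
    ∀ (q : ℕ) [NeZero q] (χ₁ : DirichletCharacter ℂ q), χ₁ ≠ 1 → χ₁.IsQuadratic → χ₁.IsPrimitive →
      ∀ β₁ : ℝ, w.IsZero q χ₁ (β₁ : ℂ) → 1 - c₀ ε / Real.log q ≤ β₁ → β₁ < 1 →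
        ∀ T : ℝ, 1 ≤ T → ∀ α : ℝ, 3 / 4 < α → α ≤ 1 →
          w.charZeroCountStrip q χ₁ α T {(β₁ : ℂ)} ≤
            C₂₈ ε * ((1 - β₁) * Real.log ((q : ℝ) * T)) *
              ((q : ℝ) ^ (7 : ℕ) * T ^ (4 : ℕ)) ^ MotohashiDH.exponent ε α
  /-- BGTZ Cor. 1.2 = `BGTZ2025.corollary12` (its ineffective `∃ C` for each `ε` is the parameter `C₁₂ ε`). -/
  rowCor12 : ∀ ε : ℝ, 0 < ε → ∀ (q : ℕ) [NeZero q], 400000 < q → ∀ T : ℝ, 4 ≤ T →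
    C₁₂ ε ≤ (q : ℝ) * T → w.repulsion (4 / 3 + ε) (2 / 3 + ε) 0 (1 / 24) q T
  /-- Kadiri ∃R₀ = `Kadiri2018.dirichlet_atMostOneZero` (its `∃ R₀ ≥ 1` is the parameter `R₀`). -/
  rowKadiri : ∀ (q : ℕ) [NeZero q], 3 ≤ q →
    ∀ (χ₁ χ₂ : DirichletCharacter ℂ q) (s₁ s₂ : ℂ), s₁ ≠ 1 → s₂ ≠ 1 →
      Kadiri2018.InRegion R₀ q s₁ → Kadiri2018.InRegion R₀ q s₂ →
      w.IsZero q χ₁ s₁ → w.IsZero q χ₂ s₂ →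
      (χ₁ = χ₂ ∧ s₁ = s₂) ∧ s₁.im = 0 ∧ χ₁ ≠ 1 ∧ χ₁ ^ 2 = 1

end ZeroWorld

/-- **`MenuInformalConsistent` (B-DH-W, the typed part of `M_informal`; S-E-bd1-3).** There are constants — `C₇ > 0`
(Thorner–Zaman Thm 7), functions `c₀, C₂₈ : ℝ → ℝ` positive on `ε > 0` (Motohashi), `C₁₂ : ℝ → ℝ` (BGTZ Cor. 1.2),
`R₀ ≥ 1` (Kadiri) — chosen ONCE, such that for every modulus `D` with `log D ≥ 43 250` and every primitive quadratic
`χ ≠ χ₀` mod `D` the (A)-world `world D χ` satisfies the informal menu with those constants. Conjoined with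
`MenuConsistent` (PROVED, p468827) and `MenuConsistentPrimes` it is the B-dh certificate over `M_typed ∪ M_primes ∪
(typed M_informal)`; untyped rows stay outside. [cite: Zhang2022LandauSiegel, §2 Assumption (A)] -/
def MenuInformalConsistent : Prop :=
  ∃ C₇ : ℝ, 0 < C₇ ∧ ∃ c₀ : ℝ → ℝ, (∀ ε : ℝ, 0 < ε → 0 < c₀ ε) ∧
    ∃ C₂₈ : ℝ → ℝ, (∀ ε : ℝ, 0 < ε → 0 < C₂₈ ε) ∧ ∃ C₁₂ : ℝ → ℝ, ∃ R₀ : ℝ, 1 ≤ R₀ ∧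
      ∀ (D : ℕ) [NeZero D] (χ : DirichletCharacter ℂ D), χ.IsPrimitive → χ.IsQuadratic → χ ≠ 1 →
        (43250 : ℝ) ≤ Real.log D → (world D χ).MenuInformal C₇ c₀ C₂₈ C₁₂ R₀

/-! ## 3. The (A)-world's boxes: structural lemmas -/

section World

variable {D : ℕ} {χ : DirichletCharacter ℂ D}

/-- A slot's `Re ≥ σ` box lies in (fence of the conductor below the height) `∪ {β₁, 1 − β₁}`.
[cite: Zhang2022LandauSiegel, §2 Assumption (A)] -/
theorem world_zeroSetGe_subset {q : ℕ} (ψ : DirichletCharacter ℂ q) (σ T : ℝ) :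
    (world D χ).zeroSetGe q ψ σ T ⊆ (fence ψ.conductor ∩ {ρ | |ρ.im| ≤ T}) ∪ excPair D := by
  rintro ρ ⟨hz, -, hT⟩
  rw [isZero_world_iff] at hz
  rcases hz with hf | ⟨-, hp⟩
  · exact Or.inl ⟨hf, hT⟩
  · exact Or.inr hp

/-- A slot's `Re ≥ σ` box below a height is finite (conductor `≥ 1`). [cite: ThornerZaman2024PNTAP, §2 p.6] -/
theorem world_zeroSetGe_finite {q : ℕ} (ψ : DirichletCharacter ℂ q) (hc : 1 ≤ ψ.conductor) (σ : ℝ) {T : ℝ}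
    (hT : 0 ≤ T) : ((world D χ).zeroSetGe q ψ σ T).Finite :=
  ((fence_box_finite hc hT).union excPair_finite).subset (world_zeroSetGe_subset ψ σ T)

/-- A slot's `Re ≥ σ` box below a height `T ≥ 0` has at most `2·fenceCount (cond ψ) T + 2` points.
[cite: ThornerZaman2024PNTAP, §2 p.6] -/
theorem world_zeroSetGe_ncard_le {q : ℕ} (ψ : DirichletCharacter ℂ q) (hc : 1 ≤ ψ.conductor) (σ : ℝ) {T : ℝ}
    (hT : 0 ≤ T) : ((world D χ).zeroSetGe q ψ σ T).ncard ≤ 2 * fenceCount ψ.conductor T + 2 :=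
  calc ((world D χ).zeroSetGe q ψ σ T).ncard
      ≤ _ := Set.ncard_le_ncard (world_zeroSetGe_subset ψ σ T) ((fence_box_finite hc hT).union excPair_finite)
    _ ≤ _ := Set.ncard_union_le _ _
    _ ≤ 2 * fenceCount ψ.conductor T + 2 := add_le_add (fence_box_ncard_le hc hT) excPair_ncard_le

/-- The `Re ≥ σ` box is monotone in the height. [cite: ThornerZaman2024PNTAP, §2 p.6] -/
theorem world_zeroSetGe_mono {q : ℕ} (ψ : DirichletCharacter ℂ q) (σ : ℝ) {T T' : ℝ} (h : T ≤ T') :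
    (world D χ).zeroSetGe q ψ σ T ⊆ (world D χ).zeroSetGe q ψ σ T' := by
  rintro ρ ⟨hz, hσ, hT⟩
  exact ⟨hz, hσ, hT.trans h⟩

variable (hL : (43250 : ℝ) ≤ Real.log D)
include hL

/-- Above `Re s = ½` a slot's box holds at most `β₁(D)`, and only on an induced slot.
[cite: Zhang2022LandauSiegel, §2 Assumption (A)] -/
theorem world_zeroSetGe_subset_of_half_lt {q : ℕ} (ψ : DirichletCharacter ℂ q) {σ : ℝ} (hσ : 1 / 2 < σ) (T : ℝ) :
    (world D χ).zeroSetGe q ψ σ T ⊆ {ρ | IsExcSlot D χ q ψ ∧ ρ = ((betaExc D : ℝ) : ℂ)} := by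
  rintro ρ ⟨hz, hσρ, -⟩
  exact re_gt_half_zero hL hz (lt_of_lt_of_le hσ hσρ)

/-- For `σ > ½` the repulsive modulus count of the world VANISHES at an induced exceptional slot.
[cite: ThornerZaman2024PNTAP, Theorem 7 p.6] -/
theorem world_modZeroCountExcl_eq_zero {q : ℕ} [NeZero q] {χ₁ : DirichletCharacter ℂ q} (hs : IsExcSlot D χ q χ₁)
    {σ : ℝ} (hσ : 1 / 2 < σ) (T : ℝ) :
    (world D χ).modZeroCountExcl q χ₁ (betaExc D) σ T = 0 := by
  unfold ZeroWorld.modZeroCountExcl ZeroWorld.charZeroCountGe ZeroWorld.charZeroCountGeExcl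
  have hsum : (∑ ψ : DirichletCharacter ℂ q,
      if ψ = χ₁ then 0 else ((world D χ).zeroSetGe q ψ σ T).ncard) = 0 := by
    refine Finset.sum_eq_zero fun ψ _ => ?_
    split_ifs with hψ
    · rfl
    · have hempty : (world D χ).zeroSetGe q ψ σ T = ∅ := by
        ext ρ
        simp only [Set.mem_empty_iff_false, iff_false]
        intro hρ
        obtain ⟨hs', -⟩ := world_zeroSetGe_subset_of_half_lt hL ψ hσ T hρ
        exact hψ (hs'.eq_of_eq hs)
      rw [hempty, Set.ncard_empty]
  have hexcl : ((world D χ).zeroSetGe q χ₁ σ T \ {((betaExc D : ℝ) : ℂ)}).ncard = 0 := by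
    have hempty : (world D χ).zeroSetGe q χ₁ σ T \ {((betaExc D : ℝ) : ℂ)} = ∅ := by
      ext ρ
      simp only [Set.mem_sdiff, Set.mem_singleton_iff, Set.mem_empty_iff_false, iff_false, not_and, not_not]
      intro hρ
      exact (world_zeroSetGe_subset_of_half_lt hL χ₁ hσ T hρ).2
    rw [hempty, Set.ncard_empty]
  rw [hsum, hexcl]

omit hL in
/-- For ANY `σ`, `T ≥ 1` and `q ≥ 3` the repulsive modulus count of the world is at most `2(qT)³`
(each of the `≤ q` slots contributes `≤ 2·fenceCount + 2 ≤ (qT)²`). [cite: ThornerZaman2024PNTAP, Theorem 7 p.6] -/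
theorem world_modZeroCountExcl_le {q : ℕ} [NeZero q] (hq : 3 ≤ q) (χ₁ : DirichletCharacter ℂ q) (β₁ σ : ℝ) {T : ℝ}
    (hT : 1 ≤ T) : ((world D χ).modZeroCountExcl q χ₁ β₁ σ T : ℝ) ≤ 2 * ((q : ℝ) * T) ^ 3 := by
  have hq3 : (3 : ℝ) ≤ q := by exact_mod_cast hq
  have hQ : (3 : ℝ) ≤ (q : ℝ) * T := by nlinarith
  have hT0 : 0 ≤ T := by linarith
  have hTle : T ≤ (q : ℝ) * T := by nlinarith
  -- per-slot bound `ncard ≤ (qT)²`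
  have hslot : ∀ ψ : DirichletCharacter ℂ q, (((world D χ).zeroSetGe q ψ σ T).ncard : ℝ) ≤ ((q : ℝ) * T) ^ 2 := by
    intro ψ
    have hc : 1 ≤ ψ.conductor := Nat.one_le_iff_ne_zero.mpr (DirichletCharacter.conductor_ne_zero ψ)
    have hcQ : (ψ.conductor : ℝ) ≤ (q : ℝ) * T := by
      have h1 : ψ.conductor ≤ q := Nat.le_of_dvd (Nat.pos_of_ne_zero (NeZero.ne q)) ψ.conductor_dvd_level
      have h2 : (ψ.conductor : ℝ) ≤ q := by exact_mod_cast h1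
      nlinarith
    have hmono := Set.ncard_le_ncard (world_zeroSetGe_mono (D := D) (χ := χ) ψ σ hTle)
      (world_zeroSetGe_finite ψ hc σ (by positivity))
    have hbox := world_zeroSetGe_ncard_le (D := D) (χ := χ) ψ hc σ (T := (q : ℝ) * T) (by positivity)
    have hB := two_fenceCount_add_two_le hc hQ hcQ
    calc (((world D χ).zeroSetGe q ψ σ T).ncard : ℝ)
        ≤ ((2 * fenceCount ψ.conductor ((q : ℝ) * T) + 2 : ℕ) : ℝ) := by exact_mod_cast hmono.trans hbox
      _ ≤ ((q : ℝ) * T) ^ 2 := by push_cast; exact hB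
  unfold ZeroWorld.modZeroCountExcl ZeroWorld.charZeroCountGe ZeroWorld.charZeroCountGeExcl
  push_cast
  have hsum : (∑ ψ : DirichletCharacter ℂ q,
      (if ψ = χ₁ then (0 : ℝ) else (((world D χ).zeroSetGe q ψ σ T).ncard : ℝ))) ≤ (q : ℝ) * ((q : ℝ) * T) ^ 2 := by
    calc (∑ ψ : DirichletCharacter ℂ q,
        (if ψ = χ₁ then (0 : ℝ) else (((world D χ).zeroSetGe q ψ σ T).ncard : ℝ)))
        ≤ ∑ _ψ : DirichletCharacter ℂ q, ((q : ℝ) * T) ^ 2 := by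
          refine Finset.sum_le_sum fun ψ _ => ?_
          split_ifs
          · positivity
          · exact hslot ψ
      _ = (Fintype.card (DirichletCharacter ℂ q) : ℝ) * ((q : ℝ) * T) ^ 2 := by
          rw [Finset.sum_const, nsmul_eq_mul, Finset.card_univ]
      _ ≤ (q : ℝ) * ((q : ℝ) * T) ^ 2 := by
          -- `#DirichletCharacter ℂ q = φ(q) ≤ q` (= `LogFreeDensity.card_dirichletCharacter_le`, whose module is not
          -- imported here to keep this certificate's closure small)
          have : Fintype.card (DirichletCharacter ℂ q) ≤ q := by
            rw [← Nat.card_eq_fintype_card, DirichletCharacter.card_eq_totient_of_hasEnoughRootsOfUnity ℂ q]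
            exact Nat.totient_le _
          exact mul_le_mul_of_nonneg_right (by exact_mod_cast this) (by positivity)
  have hexcl : ((((world D χ).zeroSetGe q χ₁ σ T \ {((β₁ : ℝ) : ℂ)}).ncard : ℕ) : ℝ) ≤ ((q : ℝ) * T) ^ 2 := by
    have hc : 1 ≤ χ₁.conductor := Nat.one_le_iff_ne_zero.mpr (DirichletCharacter.conductor_ne_zero χ₁)
    have h := Set.ncard_le_ncard (Set.sdiff_subset : (world D χ).zeroSetGe q χ₁ σ T \ {((β₁ : ℝ) : ℂ)} ⊆ _)
      (world_zeroSetGe_finite χ₁ hc σ hT0)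
    calc ((((world D χ).zeroSetGe q χ₁ σ T \ {((β₁ : ℝ) : ℂ)}).ncard : ℕ) : ℝ)
        ≤ (((world D χ).zeroSetGe q χ₁ σ T).ncard : ℝ) := by exact_mod_cast h
      _ ≤ ((q : ℝ) * T) ^ 2 := hslot χ₁
  have hqle : (q : ℝ) ≤ (q : ℝ) * T := by nlinarith
  have hX1 : (1 : ℝ) ≤ (q : ℝ) * T := by linarith
  have hX2 : 0 ≤ ((q : ℝ) * T) ^ 2 := by positivity
  have h1 : (q : ℝ) * ((q : ℝ) * T) ^ 2 ≤ ((q : ℝ) * T) ^ 3 := by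
    have : ((q : ℝ) * T) ^ 3 = ((q : ℝ) * T) * ((q : ℝ) * T) ^ 2 := by ring
    rw [this]; exact mul_le_mul_of_nonneg_right hqle hX2
  have h2 : ((q : ℝ) * T) ^ 2 ≤ ((q : ℝ) * T) ^ 3 := by
    have : ((q : ℝ) * T) ^ 3 = ((q : ℝ) * T) * ((q : ℝ) * T) ^ 2 := by ring
    rw [this]; nlinarith
  linarith [hsum, hexcl]

/-- The exceptional pair of the world sits on an induced slot, with `β₁ = β₁(D)`: `(β₁, χ₁)` "exists" at level `q` only if
`D ∣ q`, `χ₁ = χ` raised to level `q` and `β₁ = betaExc D`. [cite: ThornerZaman2024PNTAP, §1 (β₁,χ₁) p.3] -/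
theorem world_exceptionalPair_exc {q : ℕ} [NeZero q] {χ₁ : DirichletCharacter ℂ q} {β₁ : ℝ}
    (h : (world D χ).exceptionalPair χ₁ β₁) : IsExcSlot D χ q χ₁ ∧ β₁ = betaExc D := by
  obtain ⟨hne, -, hlo, -, hz⟩ := h
  have hq2 : (2 : ℝ) ≤ q := by
    have h1 : q ≠ 1 := by
      rintro rfl
      exact hne (DirichletCharacter.level_one χ₁)
    have h0 : q ≠ 0 := NeZero.ne q
    exact_mod_cast (show 2 ≤ q by omega)
  have hlog : 0.6931471803 < Real.log (q : ℝ) :=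
    lt_of_lt_of_le Real.log_two_gt_d9 (Real.log_le_log (by norm_num) hq2)
  have h50 : 1 / (50 * Real.log q) < 1 / (50 * 0.6931471803) :=
    div_lt_div_of_pos_left (by norm_num) (by norm_num) (by nlinarith)
  have h50' : (1 : ℝ) / (50 * 0.6931471803) < 1 / 2 := by norm_num
  exact real_zero_gt_half hL hz (by linarith)

/-! ## 4. The rows on the world -/

/-- **Row dhE-07 on the world** (Thorner–Zaman Thm 7, repulsive part) with the UNIFORM constant `C₇ = 2`: vanishes for
`σ > ½`; for `σ ≤ ½`, `N* ≤ 2(qT)³ ≤ 2·δ𝓛(qT)⁹ ≤ 2·ν(qT)·(qT)^{75(1−σ)/4}` using `qT ≥ D = e^𝓛`, `log(qT) ≥ 𝓛` and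
`δ·𝓛·e^{6𝓛} ≥ 1`. [cite: ThornerZaman2024PNTAP, Theorem 7 (second display) p.6] -/
theorem world_rowInformal07 : ∀ (q : ℕ) [NeZero q] (χ₁ : DirichletCharacter ℂ q) (β₁ : ℝ),
    (world D χ).exceptionalPair χ₁ β₁ → ∀ (T σ : ℝ), 1 ≤ T → 0 ≤ σ → σ ≤ 1 →
      ((world D χ).modZeroCountExcl q χ₁ β₁ σ T : ℝ) ≤
        2 * nu β₁ ((q : ℝ) * T) * ((q : ℝ) * T) ^ ((75 : ℝ) / 4 * (1 - σ)) := by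
  intro q _ χ₁ β₁ hpair T σ hT _ hσ1
  have hD0 := cast_pos_of_hL hL
  have hl0 := log_pos_of_hL hL
  set L := Real.log (D : ℝ) with hLdef
  obtain ⟨hs, rfl⟩ := world_exceptionalPair_exc hL hpair
  have hDq : (D : ℝ) ≤ q := hs.cast_le
  have hq3 : 3 ≤ q := le_trans (three_le_of_hL hL) (by exact_mod_cast hDq)
  have hq0 : (0 : ℝ) < q := by exact_mod_cast lt_of_lt_of_le (by norm_num : 0 < 3) hq3
  set X : ℝ := (q : ℝ) * T with hXdef
  have hXD : (D : ℝ) ≤ X := by rw [hXdef]; nlinarith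
  have hX1 : 1 ≤ X := le_trans (by linarith [ten_pow_ten_lt_of_hL hL]) hXD
  have hX0 : 0 < X := by linarith
  have hβ1 : betaExc D < 1 := (betaExc_window hL).2
  have hδ : 1 - betaExc D = DHMenuLines.delta L := one_sub_betaExc D
  have hδpos : 0 < 1 - betaExc D := by linarith
  -- the repulsion factor is non-negative, the power is positive
  have hnu0 : 0 ≤ nu (betaExc D) X := nu_nonneg hβ1.le hX1
  have hpow0 : 0 < X ^ ((75 : ℝ) / 4 * (1 - σ)) := Real.rpow_pos_of_pos hX0 _
  by_cases hσ : 1 / 2 < σ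
  · rw [world_modZeroCountExcl_eq_zero hL hs hσ T]
    push_cast
    positivity
  · push Not at hσ
    -- LHS ≤ 2 X³
    have hLHS := world_modZeroCountExcl_le (χ := χ) hq3 χ₁ (betaExc D) σ hT
    -- X^{75(1-σ)/4} ≥ X^9
    have hexp : (9 : ℝ) ≤ (75 : ℝ) / 4 * (1 - σ) := by nlinarith
    have hpow9 : X ^ (9 : ℕ) ≤ X ^ ((75 : ℝ) / 4 * (1 - σ)) := by
      rw [← Real.rpow_natCast]
      exact Real.rpow_le_rpow_of_exponent_le hX1 (by exact_mod_cast hexp)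
    -- ν ≥ δ·L
    have hlogX : L ≤ Real.log X := Real.log_le_log hD0 hXD
    have hδL1 : (1 - betaExc D) * L ≤ 1 := by
      rw [hδ]; unfold DHMenuLines.delta
      rw [div_mul_eq_mul_div, div_le_one (by positivity)]
      have : L ≤ L ^ 2022 := le_self_pow₀ (by linarith) (by norm_num)
      nlinarith
    have hnu : (1 - betaExc D) * L ≤ nu (betaExc D) X := by
      unfold nu
      exact le_min hδL1 (mul_le_mul_of_nonneg_left hlogX hδpos.le)
    -- δ·L·e^{6L} ≥ 1 from Bordignon's line `100 e^{-L/2}/L² < δ`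
    have hkey : 1 ≤ (1 - betaExc D) * L * Real.exp (6 * L) := by
      have hB := DHMenuLines.bordignon_lt_delta hL
      rw [← hδ] at hB
      have hE : 0 < Real.exp (-(L / 2)) := Real.exp_pos _
      have hprod : Real.exp (-(L / 2)) * Real.exp (6 * L) = Real.exp (11 / 2 * L) := by
        rw [← Real.exp_add]; ring_nf
      have h55 : 11 / 2 * L ≤ Real.exp (11 / 2 * L) := by linarith [Real.add_one_le_exp (11 / 2 * L)]
      -- `(1-β) L e^{6L} ≥ (100 e^{-L/2}/L²) L e^{6L} = 100 e^{5.5 L}/L ≥ 550`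
      have h1 : 100 * Real.exp (-(L / 2)) / L ^ 2 * L * Real.exp (6 * L) = 100 * Real.exp (11 / 2 * L) / L := by
        rw [← hprod]; field_simp
      have h2 : 100 * Real.exp (-(L / 2)) / L ^ 2 * L * Real.exp (6 * L) ≤ (1 - betaExc D) * L * Real.exp (6 * L) := by
        have : 0 ≤ L * Real.exp (6 * L) := by positivity
        nlinarith
      have h3 : (1 : ℝ) ≤ 100 * Real.exp (11 / 2 * L) / L := by
        rw [le_div_iff₀ hl0]; nlinarith
      linarith [h1 ▸ h2]
    -- X^6 ≥ e^{6L}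
    have hX6 : Real.exp (6 * L) ≤ X ^ (6 : ℕ) := by
      have hDexp : Real.exp L = D := by rw [hLdef, Real.exp_log hD0]
      calc Real.exp (6 * L) = Real.exp L ^ 6 := by rw [← Real.exp_nat_mul]; norm_num
        _ ≤ X ^ 6 := by rw [hDexp]; exact pow_le_pow_left₀ hD0.le hXD 6
    -- assemble
    have hchain : 2 * X ^ 3 ≤ 2 * nu (betaExc D) X * X ^ ((75 : ℝ) / 4 * (1 - σ)) := by
      have hA : X ^ 3 ≤ (1 - betaExc D) * L * X ^ (9 : ℕ) := by
        have : (1 - betaExc D) * L * X ^ (9 : ℕ) = ((1 - betaExc D) * L * X ^ (6 : ℕ)) * X ^ 3 := by ring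
        rw [this]
        have hX3 : 0 ≤ X ^ 3 := by positivity
        have h1 : 1 ≤ (1 - betaExc D) * L * X ^ (6 : ℕ) :=
          hkey.trans (mul_le_mul_of_nonneg_left hX6 (by positivity))
        nlinarith
      have hB : (1 - betaExc D) * L * X ^ (9 : ℕ) ≤ nu (betaExc D) X * X ^ ((75 : ℝ) / 4 * (1 - σ)) :=
        mul_le_mul hnu hpow9 (by positivity) hnu0
      linarith
    exact hLHS.trans (by rw [hXdef] at hchain ⊢; linarith)

/-- **Row dhE-28 on the world** (Motohashi Thm II) with the UNIFORM constants `c₀ ≡ 1/10`, `C ≡ 1`: a real zero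
`β₁ ≥ 1 − 1/(10 log q) > ½` is `β₁(D)` on an induced slot, and the open-strip box of the world has NO zero with
`Re ρ ≥ α > ¾` other than `β₁(D)` (which is excluded), so the count is `0 ≤ RHS`.
[cite: Motohashi1977DeuringHeilbronnII, Theorem p.25] -/
theorem world_rowInformal28 : ∀ ε : ℝ, 0 < ε →
    ∀ (q : ℕ) [NeZero q] (χ₁ : DirichletCharacter ℂ q), χ₁ ≠ 1 → χ₁.IsQuadratic → χ₁.IsPrimitive →
      ∀ β₁ : ℝ, (world D χ).IsZero q χ₁ (β₁ : ℂ) → 1 - (1 / 10 : ℝ) / Real.log q ≤ β₁ → β₁ < 1 →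
        ∀ T : ℝ, 1 ≤ T → ∀ α : ℝ, 3 / 4 < α → α ≤ 1 →
          (world D χ).charZeroCountStrip q χ₁ α T {(β₁ : ℂ)} ≤
            (1 : ℝ) * ((1 - β₁) * Real.log ((q : ℝ) * T)) *
              ((q : ℝ) ^ (7 : ℕ) * T ^ (4 : ℕ)) ^ MotohashiDH.exponent ε α := by
  intro ε hε q _ χ₁ hne _ _ β₁ hz hlo hβ1 T hT α hα _
  -- `q ≥ 3` would follow from primitivity; `q ≥ 2` from `χ₁ ≠ 1` suffices
  have hq2 : (2 : ℝ) ≤ q := by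
    have h1 : q ≠ 1 := by
      rintro rfl
      exact hne (DirichletCharacter.level_one χ₁)
    have h0 : q ≠ 0 := NeZero.ne q
    exact_mod_cast (show 2 ≤ q by omega)
  have hlog : 0.6931471803 < Real.log (q : ℝ) :=
    lt_of_lt_of_le Real.log_two_gt_d9 (Real.log_le_log (by norm_num) hq2)
  -- RHS ≥ 0
  have hRHS : 0 ≤ (1 : ℝ) * ((1 - β₁) * Real.log ((q : ℝ) * T)) *
      ((q : ℝ) ^ (7 : ℕ) * T ^ (4 : ℕ)) ^ MotohashiDH.exponent ε α := by
    have h1 : 0 ≤ Real.log ((q : ℝ) * T) := Real.log_nonneg (by nlinarith)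
    have h2 : 0 ≤ 1 - β₁ := by linarith
    have h3 : 0 ≤ ((q : ℝ) ^ (7 : ℕ) * T ^ (4 : ℕ)) ^ MotohashiDH.exponent ε α :=
      Real.rpow_nonneg (by positivity) _
    positivity
  -- `β₁ = β₁(D)` on an induced slot
  have hβhalf : 1 / 2 < β₁ := by
    have : (1 / 10 : ℝ) / Real.log q < (1 / 10) / 0.6931471803 := div_lt_div_of_pos_left (by norm_num) (by norm_num) hlog
    have h' : (1 / 10 : ℝ) / 0.6931471803 < 1 / 2 := by norm_num
    linarith
  obtain ⟨hs, rfl⟩ := real_zero_gt_half hL hz hβhalf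
  -- the count vanishes
  have hzero : (world D χ).charZeroCountStrip q χ₁ α T {((betaExc D : ℝ) : ℂ)} = 0 := by
    unfold ZeroWorld.charZeroCountStrip
    split_ifs with hfin
    · refine Finset.sum_eq_zero fun ρ hρ => ?_
      exfalso
      rw [Finset.mem_filter, Finset.mem_sdiff, Set.Finite.mem_toFinset, Finset.mem_singleton] at hρ
      obtain ⟨⟨⟨hzρ, -, -, -⟩, hne'⟩, hαρ⟩ := hρ
      obtain ⟨-, hρeq⟩ := re_gt_half_zero hL hzρ (by linarith)
      exact hne' hρeq
    · rfl
  rw [hzero]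
  exact hRHS

/-- **Row BGTZ Cor. 1.2 on the world: VACUOUS** (like row01 of E-057) — a zero `ρ ≠ β₁` with `Re ρ > ½` does not exist
in `W(D, χ)`; any `C(ε)` (here `0`) will do. [cite: BenliGoelTwissZaman2025, Corollary 1.2] -/
theorem world_rowInformalCor12 : ∀ ε : ℝ, 0 < ε → ∀ (q : ℕ) [NeZero q], 400000 < q → ∀ T : ℝ, 4 ≤ T →
    (0 : ℝ) ≤ (q : ℝ) * T → (world D χ).repulsion (4 / 3 + ε) (2 / 3 + ε) 0 (1 / 24) q T := by
  intro ε _ q _ hq T _ _ χ₁ β₁ hlo _ hz1 ψ ρ _ hne hz hre _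
  exfalso
  have hq3 : 3 ≤ q := by omega
  obtain ⟨-, hβ⟩ := real_zero_gt_half hL hz1 (half_lt_of_window hq3 hlo)
  obtain ⟨-, hρ⟩ := re_gt_half_zero hL hz hre
  exact hne (by rw [hρ, hβ])

/-- **Row "Kadiri ∃R₀" on the world** with the UNIFORM `R₀ = 10`: for `q ≥ 3` the region
`Re s ≥ 1 − 1/(10 log max{q, q|Im s|})` lies in `Re s > ½`, where the only zero is `β₁(D)` on the unique induced slot of
the level — real, of the quadratic character `changeLevel χ ≠ χ₀`. [cite: Kadiri2018, Theorem 1.1] -/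
theorem world_rowInformalKadiri (hχ : χ ≠ 1) (hquad : χ.IsQuadratic) : ∀ (q : ℕ) [NeZero q], 3 ≤ q →
    ∀ (χ₁ χ₂ : DirichletCharacter ℂ q) (s₁ s₂ : ℂ), s₁ ≠ 1 → s₂ ≠ 1 →
      Kadiri2018.InRegion 10 q s₁ → Kadiri2018.InRegion 10 q s₂ →
      (world D χ).IsZero q χ₁ s₁ → (world D χ).IsZero q χ₂ s₂ →
      (χ₁ = χ₂ ∧ s₁ = s₂) ∧ s₁.im = 0 ∧ χ₁ ≠ 1 ∧ χ₁ ^ 2 = 1 := by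
  -- the region lies inside `Re s > 1/2` for `q ≥ 3`
  have hregion : ∀ (q : ℕ), 3 ≤ q → ∀ s : ℂ, Kadiri2018.InRegion 10 q s → 1 / 2 < s.re := by
    intro q hq s hs
    unfold Kadiri2018.InRegion at hs
    have hq3 : (3 : ℝ) ≤ q := by exact_mod_cast hq
    have hlog : 1 < Real.log (max (q : ℝ) ((q : ℝ) * |s.im|)) := by
      have h3 : Real.log 3 ≤ Real.log (max (q : ℝ) ((q : ℝ) * |s.im|)) :=
        Real.log_le_log (by norm_num) (le_trans hq3 (le_max_left _ _))
      have h13 : (1 : ℝ) < Real.log 3 := by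
        rw [Real.lt_log_iff_exp_lt (by norm_num)]
        have := Real.exp_one_lt_d9
        linarith
      linarith
    have : 1 / (10 * Real.log (max (q : ℝ) ((q : ℝ) * |s.im|))) ≤ 1 / (10 * 1) :=
      div_le_div_of_nonneg_left (by norm_num) (by norm_num) (by nlinarith)
    have h2 : (1 : ℝ) / (10 * 1) < 1 / 2 := by norm_num
    linarith
  intro q _ hq χ₁ χ₂ s₁ s₂ _ _ h1 h2 hz1 hz2
  obtain ⟨hs1, rfl⟩ := re_gt_half_zero hL hz1 (hregion q hq _ h1)
  obtain ⟨hs2, rfl⟩ := re_gt_half_zero hL hz2 (hregion q hq _ h2)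
  have h12 : χ₁ = χ₂ := hs1.eq_of_eq hs2
  obtain ⟨hd, hχ₁⟩ := hs1
  refine ⟨⟨h12, rfl⟩, Complex.ofReal_im _, ?_, ?_⟩
  · rw [hχ₁, Ne, DirichletCharacter.changeLevel_eq_one_iff hd]
    exact hχ
  · rw [hχ₁, ← map_pow, hquad.sq_eq_one, map_one]

end World

/-! ## 5. The certificate -/

/-- **`MenuInformalConsistent` HOLDS** — witnesses `C₇ = 2`, `c₀ ≡ 1/10`, `C₂₈ ≡ 1`, `C₁₂ ≡ 0`, `R₀ = 10`, all chosen
before `D`. [cite: Zhang2022LandauSiegel, §2 Assumption (A)] -/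
theorem menuInformalConsistent_holds : MenuInformalConsistent := by
  refine ⟨2, by norm_num, fun _ => 1 / 10, fun _ _ => by norm_num, fun _ => 1, fun _ _ => by norm_num,
    fun _ => 0, 10, by norm_num, ?_⟩
  intro D _ χ _ hquad hχ hL
  exact
    { row07 := world_rowInformal07 hL
      row28 := world_rowInformal28 hL
      rowCor12 := world_rowInformalCor12 hL
      rowKadiri := world_rowInformalKadiri hL hχ hquad }

end Literature.NumberTheory.LFunctions.Zhang2022.DH

end
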